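import Mathlib
import Summits.Ventures.PercRepro2.TypedSeparated
import Summits.Ventures.PercRepro2.TypedSeparatedZero
import Summits.Ventures.PercRepro2.TypedSeparatedCrossA
import Summits.Ventures.PercRepro2.TypedSeparatedCrossB
import Summits.Ventures.PercRepro2.TypedSeparatedCrossC
import Summits.Ventures.PercRepro2.TypedSwapRoots

/-!
# Row 2′TRI on the whole separated class (blind cell PercRepro2, night-3 g5, 2026-08-25;
`proofs/NIGHT3-CERT.md` §14.8)

**`typedCount_nonneg_of_separated`**: for every finite graph, marking, pinning `z` and type map
with values in `{1, 2}` on `F`, if `a₁ ↮ a₂` in `z ∪ F` then `0 ≤ typedCount F z τ K₃`.  The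
placements of `o, b, a₃` over the `l`-side, the `h`-side and the rest are exhausted:
`o` or `b` off both sides ⇒ `0` (`typedCount_eq_zero_of_oFree / _bFree`); `o, b` on the `l`-side
⇒ `2 · A_H · (S_same − S_cross) · T₀ ≥ 0` when `a₃` is on the `h`-side (`typedCount_nonneg_of_sep`)
and `0` otherwise (`typedCount_eq_zero_of_sep_a3_offH`); `o, b` on the `h`-side ⇒ the mirror by
the root symmetry (`typedCount_swap_roots`); `o` and `b` on different sides ⇒ `0`
(`typedCount_eq_zero_of_sepStA / B / C` and their mirrors).
-/

namespace Summit.Ventures.PercRepro2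

open UnionCluster

namespace CovForm

namespace Separated

open OneTyped TypedA3 Untouched TypedFactor SwapRoots

section Main

open Classical

variable {V : Type*} {E : Type*} [Fintype E] [DecidableEq E] {R : Type*} [Field R]
  [LinearOrder R] [IsStrictOrderedRing R]
variable (ends : E → Sym2 V) (o a₁ a₂ a₃ b : V)

/-- The case `o, b` on the `l`-side (any `a₃`). -/
theorem typedCount_nonneg_of_sep_LL (F : Finset E) (z : Config E) (τ : E → ℕ)
    (hτ : ∀ e ∈ F, τ e = 1 ∨ τ e = 2) (hsep : Sep ends a₁ a₂ F z)
    (ho : Conn ends (zF F z) a₁ o) (hb : Conn ends (zF F z) a₁ b) :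
    0 ≤ typedCount F z τ (K3 ends o a₁ a₂ a₃ b : Config E → Config E → Config E → R) := by
  by_cases h3 : Conn ends (zF F z) a₂ a₃
  · exact typedCount_nonneg_of_sep ends o a₁ a₂ a₃ b F z τ hτ hsep ho hb h3
  · rw [typedCount_eq_zero_of_sep_a3_offH ends o a₁ a₂ a₃ b F z τ hτ hsep ho hb h3]

omit [IsStrictOrderedRing R] in
/-- The case `o` on the `l`-side, `b` on the `h`-side (any `a₃`). -/
theorem typedCount_nonneg_of_sep_LH (F : Finset E) (z : Config E) (τ : E → ℕ)
    (hτ : ∀ e ∈ F, τ e = 1 ∨ τ e = 2) (hsep : Sep ends a₁ a₂ F z)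
    (ho : Conn ends (zF F z) a₁ o) (hb : Conn ends (zF F z) a₂ b) :
    0 ≤ typedCount F z τ (K3 ends o a₁ a₂ a₃ b : Config E → Config E → Config E → R) := by
  by_cases h3h : Conn ends (zF F z) a₂ a₃
  · rw [typedCount_eq_zero_of_sepStA ends o a₁ a₂ a₃ b F z τ hτ hsep ho hb h3h]
  · by_cases h3l : Conn ends (zF F z) a₁ a₃
    · rw [typedCount_eq_zero_of_sepStB ends o a₁ a₂ a₃ b F z τ hτ hsep ho hb h3l]
    · rw [typedCount_eq_zero_of_sepStC ends o a₁ a₂ a₃ b F z τ hτ hsep ho hb h3l h3h]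

omit [Fintype E] in
/-- `Sep` is symmetric in the roots. -/
lemma sep_symm (F : Finset E) (z : Config E) (hsep : Sep ends a₁ a₂ F z) : Sep ends a₂ a₁ F z :=
  fun h => hsep (conn_symm h)

/-- **Row 2′TRI on the separated class**: if `a₁ ↮ a₂` in `z ∪ F`, every typed base with types
in `{1, 2}` is nonnegative. -/
theorem typedCount_nonneg_of_separated (F : Finset E) (z : Config E) (τ : E → ℕ)
    (hτ : ∀ e ∈ F, τ e = 1 ∨ τ e = 2) (hsep : Sep ends a₁ a₂ F z) :
    0 ≤ typedCount F z τ (K3 ends o a₁ a₂ a₃ b : Config E → Config E → Config E → R) := by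
  have hsep' : Sep ends a₂ a₁ F z := sep_symm ends a₁ a₂ F z hsep
  by_cases hLo : Conn ends (zF F z) a₁ o
  · by_cases hLb : Conn ends (zF F z) a₁ b
    · exact typedCount_nonneg_of_sep_LL ends o a₁ a₂ a₃ b F z τ hτ hsep hLo hLb
    · by_cases hHb : Conn ends (zF F z) a₂ b
      · exact typedCount_nonneg_of_sep_LH ends o a₁ a₂ a₃ b F z τ hτ hsep hLo hHb
      · rw [typedCount_eq_zero_of_bFree ends o a₁ a₂ a₃ b F z τ hτ hLb hHb]
  · by_cases hHo : Conn ends (zF F z) a₂ o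
    · -- `o` on the `h`-side: exchange the roots
      rw [← typedCount_swap_roots ends o a₁ a₂ a₃ b F z τ]
      by_cases hHb : Conn ends (zF F z) a₂ b
      · exact typedCount_nonneg_of_sep_LL ends o a₂ a₁ a₃ b F z τ hτ hsep' hHo hHb
      · by_cases hLb : Conn ends (zF F z) a₁ b
        · exact typedCount_nonneg_of_sep_LH ends o a₂ a₁ a₃ b F z τ hτ hsep' hHo hLb
        · rw [typedCount_eq_zero_of_bFree ends o a₂ a₁ a₃ b F z τ hτ hHb hLb]
    · rw [typedCount_eq_zero_of_oFree ends o a₁ a₂ a₃ b F z τ hτ hLo hHo]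

/-- **The full class, under the name the crux assembly consumes**: `Sep` alone gives `0 ≤ typedCount`. -/
theorem typedCount_nonneg_of_sep_all (F : Finset E) (z : Config E) (τ : E → ℕ)
    (hτ : ∀ e ∈ F, τ e = 1 ∨ τ e = 2) (hsep : Sep ends a₁ a₂ F z) :
    0 ≤ typedCount F z τ (K3 ends o a₁ a₂ a₃ b : Config E → Config E → Config E → R) :=
  typedCount_nonneg_of_separated ends o a₁ a₂ a₃ b F z τ hτ hsep

omit [Fintype E] in
/-- At the all-closed pinning, `z ∪ F` is the typed graph itself. -/
lemma zF_false (F : Finset E) : zF F (fun _ => false) = fun e => decide (e ∈ F) := by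
  funext e
  simp [zF]

/-- **The separated part of the residual class (sub-claim S1/S2 interface)**: at the all-closed
pinning, if `a₁` and `a₂` lie in different components of the typed graph `(V, F)`, the typed base
is nonnegative — the statement `ResidualSep_all` of the crux assembly, hypothesis for hypothesis
(the `Residual` side conditions are not needed). -/
theorem typedCount_nonneg_of_typedConfig_sep (F : Finset E) (τ : E → ℕ)
    (hτ : ∀ e ∈ F, τ e = 1 ∨ τ e = 2) (hsep : ¬ Conn ends (fun e => decide (e ∈ F)) a₁ a₂) :
    0 ≤ typedCount F (fun _ => false) τ
      (K3 ends o a₁ a₂ a₃ b : Config E → Config E → Config E → R) := by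
  refine typedCount_nonneg_of_separated ends o a₁ a₂ a₃ b F (fun _ => false) τ hτ ?_
  intro h
  rw [zF_false] at h
  exact hsep (conn_symm h)

end Main

end Separated

end CovForm

end Summit.Ventures.PercRepro2
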